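import Summits.KontsevichZagierPeriods.KontsevichZagierPeriods.Theorems.HurwitzMicroSectorsNormalFormPrincipleLevelOne
import Summits.KontsevichZagierPeriods.KontsevichZagierPeriods.Theorems.HurwitzMicroSectorsNormalFormPrincipleSlabASubPtK20
import Summits.KontsevichZagierPeriods.KontsevichZagierPeriods.Theorems.HurwitzMicroSectorsNormalFormPrincipleAlgCarriers
import Summits.KontsevichZagierPeriods.KontsevichZagierPeriods.Theorems.HurwitzMicroSectorsNormalFormPrincipleM2FiveZetaTwo
import Literature.NumberTheory.Transcendental.KZProductIdeal

/-!
# `NormalFormPrinciple` (stmt-KontsevichZagierPeriods-3869), line `SketchIdeator1` — leaf `stub_boxRigidity`: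
# all weights, level `K`, totally off resonance: re-banding by the transposition of the last two coordinates (rule 2)

Registered sub-goal `rebandN` of the layer "Conjecture 1 for the weight-`w` boxes
`[(0,1)^w, c (Π_l x_l^{e_l})/(1 − Π_l x_l^K)]` totally off resonance" (lead file `…WeightN`); the
dimension-generic version of the weight-three lemma `…PiBox.Weight3.reband3`.
The merged representation `R = [B, g]` on the band
`B = {z | (z_0,…,z_n) ∈ (0,1)^{n+1}, 0 ≤ z_{n+1} ≤ Π_{i≤n} z_i} ⊆ ℝ^{n+2}` over the open box, with
`g = c (Π_{i≤n} z_i^{A_i}) z_{n+1}^D/(1 − z_{n+1}^K)` on `B`, and the representation `R' = [B', g']`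
on the NESTED band
`B' = {z | (z_0,…,z_{n-1}) ∈ (0,1)^n, 0 ≤ z_n ≤ Π_{i<n} z_i, z_n/Π_{i<n} z_i ≤ z_{n+1} ≤ 1}`
with `g' z = g (z ∘ σ)` on `B'`, `σ` the transposition of the last two coordinates of `ℝ^{n+2}`,
differ by a relation of the Kontsevich–Zagier calculus:

1. (rule 2) transpose the last two coordinates (`KZ.of_sub_of_reindex_mem_relations` with the
   transposition `σ = Equiv.swap (Fin.castSucc (Fin.last n)) (Fin.last (n+1))`): the domain of
   `R.reindex σ` is `W = {w | (w_0,…,w_{n-1},w_{n+1}) ∈ (0,1)^{n+1}, 0 ≤ w_n ≤ (Π_{i<n} w_i) w_{n+1}}`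
   and its integrand is `g ∘ σ`, which agrees with `g'` on `W` (`Fin.prod_univ_castSucc`);
2. (rule 1) null adjustment: `W ⊆ B'` EXACTLY (for `P = Π_{i<n} w_i > 0` and `w_{n+1} < 1`,
   `w_n ≤ P w_{n+1}` gives `w_n/P ≤ w_{n+1}` and `w_n ≤ P`), and
   `B' ∖ W ⊆ {w_{n+1} = 0} ∪ {w_{n+1} = 1}` is null (a point of `B'` with `0 < w_{n+1} < 1` has
   `w_n ≤ P w_{n+1}`, from `w_n/P ≤ w_{n+1}`; `Measure.pi_hyperplane`, `measure_union_null`), so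
   `[B', g'] − [W, g'] ∈ relations` (`KZ.IntegralRep.of_sub_of_restrict_mem_relations`), while
   `[W, g ∘ σ] − [W, g']` is a congruence (`KZ.of_sub_of_mem_relations_of_eqOn`).

References: M. Kontsevich, D. Zagier, *Periods* (2001), §1.2 rules (1), (2). No new definitions.
-/

noncomputable section

open MeasureTheory Set
open Literature.NumberTheory.Transcendental Literature.NumberTheory.Transcendental.KZ
open Literature.ModelTheory.ExponentialFields (IsSemialgebraic)

namespace Summit.KontsevichZagierPeriods.HurwitzMicroSectors.NormalFormPrinciple.PiBox.WeightN

/-! ### The transposition of the last two coordinates of `ℝ^{n+2}` -/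

/-- The transposition of the last two coordinates of `Fin (n+2)` fixes the first `n` coordinates.
[folklore] -/
theorem wn_rb_swap_castSucc_castSucc (n : ℕ) (j : Fin n) :
    Equiv.swap (Fin.castSucc (Fin.last n)) (Fin.last (n + 1)) (Fin.castSucc (Fin.castSucc j)) =
      Fin.castSucc (Fin.castSucc j) :=
  Equiv.swap_apply_of_ne_of_ne
    (fun h => (Fin.castSucc_lt_last j).ne (Fin.castSucc_injective _ h))
    (Fin.castSucc_lt_last _).ne

/-! ### Membership in the three bands -/

/-- Membership in the merged band `{z | (z_0,…,z_n) ∈ (0,1)^{n+1}, 0 ≤ z_{n+1} ≤ Π_{i≤n} z_i} ⊆ ℝ^{n+2}`,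
coordinatewise. [folklore] -/
theorem wn_rb_mem_boxBand {n : ℕ} {z : Fin (n + 2) → ℝ} :
    z ∈ KZlog.band {y : Fin (n + 1) → ℝ | ∀ i, y i ∈ Set.Ioo (0:ℝ) 1} (fun _ => (0:ℝ))
      (fun y => ∏ i, y i) ↔
      (∀ i : Fin (n + 1), z (Fin.castSucc i) ∈ Set.Ioo (0:ℝ) 1) ∧ 0 ≤ z (Fin.last (n + 1)) ∧
        z (Fin.last (n + 1)) ≤ ∏ i : Fin (n + 1), z (Fin.castSucc i) :=
  Iff.rfl

/-- Membership in the transposed band `W = {w | w ∘ σ ∈ B}` (`σ` the transposition of the last two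
coordinates, `B` the merged band), coordinatewise:
`(w_0,…,w_{n-1},w_{n+1}) ∈ (0,1)^{n+1}`, `0 ≤ w_n ≤ (Π_{i<n} w_i) w_{n+1}`. [folklore] -/
theorem wn_rb_mem_swapBand {n : ℕ} {w : Fin (n + 2) → ℝ} :
    (fun i => w (Equiv.swap (Fin.castSucc (Fin.last n)) (Fin.last (n + 1)) i)) ∈
      KZlog.band {y : Fin (n + 1) → ℝ | ∀ i, y i ∈ Set.Ioo (0:ℝ) 1} (fun _ => (0:ℝ))
        (fun y => ∏ i, y i) ↔
      ((∀ i : Fin n, w (Fin.castSucc (Fin.castSucc i)) ∈ Set.Ioo (0:ℝ) 1) ∧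
        w (Fin.last (n + 1)) ∈ Set.Ioo (0:ℝ) 1) ∧ 0 ≤ w (Fin.castSucc (Fin.last n)) ∧
        w (Fin.castSucc (Fin.last n)) ≤
          (∏ i : Fin n, w (Fin.castSucc (Fin.castSucc i))) * w (Fin.last (n + 1)) := by
  rw [wn_rb_mem_boxBand, Fin.forall_fin_succ', Fin.prod_univ_castSucc]
  simp only [wn_rb_swap_castSucc_castSucc, Equiv.swap_apply_left, Equiv.swap_apply_right]

/-- Membership in the nested band
`{z | (z_0,…,z_{n-1}) ∈ (0,1)^n, 0 ≤ z_n ≤ Π_{i<n} z_i, z_n/Π_{i<n} z_i ≤ z_{n+1} ≤ 1} ⊆ ℝ^{n+2}`,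
coordinatewise. [folklore] -/
theorem wn_rb_mem_nestedBand {n : ℕ} {z : Fin (n + 2) → ℝ} :
    z ∈ KZlog.band
      (KZlog.band {y : Fin n → ℝ | ∀ i, y i ∈ Set.Ioo (0:ℝ) 1} (fun _ => (0:ℝ)) (fun y => ∏ i, y i))
      (fun w => w (Fin.last n) / ∏ i : Fin n, w (Fin.castSucc i)) (fun _ => (1:ℝ)) ↔
      ((∀ i : Fin n, z (Fin.castSucc (Fin.castSucc i)) ∈ Set.Ioo (0:ℝ) 1) ∧
        0 ≤ z (Fin.castSucc (Fin.last n)) ∧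
        z (Fin.castSucc (Fin.last n)) ≤ ∏ i : Fin n, z (Fin.castSucc (Fin.castSucc i))) ∧
      z (Fin.castSucc (Fin.last n)) / ∏ i : Fin n, z (Fin.castSucc (Fin.castSucc i)) ≤
        z (Fin.last (n + 1)) ∧ z (Fin.last (n + 1)) ≤ 1 :=
  Iff.rfl

/-! ### The stub -/

/-- **WN (re-banding, rule 2: move the last base coordinate behind `t`; registered sub-goal of the
all-weights totally-off-resonance layer of `stub_boxRigidity`).** The band
`R_{n+1}(A; D)` over `(0,1)^{n+1}` (coordinates `(y_0,…,y_n,t)`, fibre `0 ≤ t ≤ Π yᵢ`, integrand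
`g = c (Π_{i≤n} y_i^{A_i}) t^D/(1 − t^K)`) is, up to null sets, the nested band over the
`R_n`-domain (coordinates `(y_0,…,y_{n-1},t)`) with fibre `t/(Π_{i<n} yᵢ) ≤ y_n ≤ 1`, the integrand
read in the coordinates `(y_0,…,y_{n-1},t,y_n)`: transpose the last two coordinates (rule 2,
`KZ.of_sub_of_reindex_mem_relations`) — the transposed band `W` lies inside the nested band — and
remove the null set `{y_n = 0} ∪ {y_n = 1}` containing the difference (rule 1,
`KZ.IntegralRep.of_sub_of_restrict_mem_relations`, `KZ.of_sub_of_mem_relations_of_eqOn`).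
[cite: KontsevichZagier2001, §1.2 rules (1), (2)] -/
theorem rebandN (n : ℕ) (K : ℕ) (hK : 0 < K) (A : Fin (n + 1) → ℕ) (D : ℕ) (c : ℝ)
    (hc : IsAlgebraic ℚ c) (R R' : IntegralRep (n + 2))
    (hRd : R.domain = KZlog.band {y : Fin (n + 1) → ℝ | ∀ i, y i ∈ Set.Ioo (0:ℝ) 1} (fun _ => (0:ℝ))
      (fun y => ∏ i, y i))
    (hRi : EqOn R.integrand (fun z => c * (∏ i : Fin (n + 1), z (Fin.castSucc i) ^ (A i)) *
        z (Fin.last (n + 1)) ^ D / (1 - z (Fin.last (n + 1)) ^ K)) R.domain)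
    (hR'd : R'.domain = KZlog.band
      (KZlog.band {y : Fin n → ℝ | ∀ i, y i ∈ Set.Ioo (0:ℝ) 1} (fun _ => (0:ℝ)) (fun y => ∏ i, y i))
      (fun w => w (Fin.last n) / ∏ i : Fin n, w (Fin.castSucc i)) (fun _ => (1:ℝ)))
    (hR'i : EqOn R'.integrand (fun z =>
        c * (∏ i : Fin n, z (Fin.castSucc (Fin.castSucc i)) ^ (A (Fin.castSucc i))) *
          z (Fin.last (n + 1)) ^ (A (Fin.last n)) * z (Fin.castSucc (Fin.last n)) ^ D /
          (1 - z (Fin.castSucc (Fin.last n)) ^ K)) R'.domain) :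
    of R - of R' ∈ relations := by
  have _ := hK
  have _ := hc
  -- membership in the transposed band `W` and in the nested band `B'`
  have hmemW : ∀ w : Fin (n + 2) → ℝ,
      w ∈ (R.reindex (Equiv.swap (Fin.castSucc (Fin.last n)) (Fin.last (n + 1)))).domain ↔
      ((∀ i : Fin n, w (Fin.castSucc (Fin.castSucc i)) ∈ Set.Ioo (0:ℝ) 1) ∧
        w (Fin.last (n + 1)) ∈ Set.Ioo (0:ℝ) 1) ∧ 0 ≤ w (Fin.castSucc (Fin.last n)) ∧
        w (Fin.castSucc (Fin.last n)) ≤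
          (∏ i : Fin n, w (Fin.castSucc (Fin.castSucc i))) * w (Fin.last (n + 1)) := fun w => by
    rw [IntegralRep.reindex_domain, mem_setOf_eq, hRd]
    exact wn_rb_mem_swapBand
  have hmemR' : ∀ w : Fin (n + 2) → ℝ, w ∈ R'.domain ↔
      ((∀ i : Fin n, w (Fin.castSucc (Fin.castSucc i)) ∈ Set.Ioo (0:ℝ) 1) ∧
        0 ≤ w (Fin.castSucc (Fin.last n)) ∧
        w (Fin.castSucc (Fin.last n)) ≤ ∏ i : Fin n, w (Fin.castSucc (Fin.castSucc i))) ∧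
      w (Fin.castSucc (Fin.last n)) / ∏ i : Fin n, w (Fin.castSucc (Fin.castSucc i)) ≤
        w (Fin.last (n + 1)) ∧ w (Fin.last (n + 1)) ≤ 1 := fun w => by
    rw [hR'd]
    exact wn_rb_mem_nestedBand
  -- the product of the first `n` coordinates is positive on both bands
  have hP : ∀ w : Fin (n + 2) → ℝ,
      (∀ i : Fin n, w (Fin.castSucc (Fin.castSucc i)) ∈ Set.Ioo (0:ℝ) 1) →
      0 < ∏ i : Fin n, w (Fin.castSucc (Fin.castSucc i)) := fun w hw =>
    Finset.prod_pos fun i _ => (hw i).1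
  -- the transposed band `W` is `ℚ`-semialgebraic and lies inside the nested band `B'`
  have hW : IsSemialgebraic ℚ
      (R.reindex (Equiv.swap (Fin.castSucc (Fin.last n)) (Fin.last (n + 1)))).domain :=
    (R.reindex (Equiv.swap (Fin.castSucc (Fin.last n)) (Fin.last (n + 1)))).isSemialgebraic_domain
  have hWR' : (R.reindex (Equiv.swap (Fin.castSucc (Fin.last n)) (Fin.last (n + 1)))).domain ⊆
      R'.domain := fun w hw => by
    obtain ⟨⟨h0, h2, h2'⟩, h1, h1'⟩ := (hmemW w).1 hw
    have hp := hP w h0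
    exact (hmemR' w).2 ⟨⟨h0, h1, h1'.trans (mul_le_of_le_one_right hp.le h2'.le)⟩,
      (div_le_iff₀ hp).2 (h1'.trans_eq (mul_comm _ _)), h2'.le⟩
  -- `B' ∖ W ⊆ {w_{n+1} = 0} ∪ {w_{n+1} = 1}` is null
  have hvol : volume (R'.domain \
      (R.reindex (Equiv.swap (Fin.castSucc (Fin.last n)) (Fin.last (n + 1)))).domain) = 0 := by
    refine measure_mono_null (fun w hw => ?_)
      (measure_union_null
        (Measure.pi_hyperplane (fun _ => (volume : Measure ℝ)) (Fin.last (n + 1)) 0)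
        (Measure.pi_hyperplane (fun _ => (volume : Measure ℝ)) (Fin.last (n + 1)) 1))
    rcases eq_or_ne (w (Fin.last (n + 1))) 0 with h20 | h20
    · exact Or.inl h20
    rcases eq_or_ne (w (Fin.last (n + 1))) 1 with h21 | h21
    · exact Or.inr h21
    obtain ⟨⟨h0, h1, _⟩, h12, h2⟩ := (hmemR' w).1 hw.1
    have hp := hP w h0
    refine absurd ((hmemW w).2 ⟨⟨h0, ?_, lt_of_le_of_ne h2 h21⟩, h1, ?_⟩) hw.2
    · exact lt_of_le_of_ne ((div_nonneg h1 hp.le).trans h12) (Ne.symm h20)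
    · exact ((div_le_iff₀ hp).1 h12).trans_eq (mul_comm _ _)
  -- (1) rule 2: the transposition of the last two coordinates
  have hS := of_sub_of_reindex_mem_relations R
    (Equiv.swap (Fin.castSucc (Fin.last n)) (Fin.last (n + 1)))
  -- (2) rule 1: the null adjustment of `R'` to `W` and the congruence on `W`
  have hres := IntegralRep.of_sub_of_restrict_mem_relations R' hW hWR' hvol
  have hcmp : of (R.reindex (Equiv.swap (Fin.castSucc (Fin.last n)) (Fin.last (n + 1)))) -
      of (R'.restrict _ hW hWR') ∈ relations := by
    refine of_sub_of_mem_relations_of_eqOn rfl fun w hw => ?_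
    have hw' : (fun i => w (Equiv.swap (Fin.castSucc (Fin.last n)) (Fin.last (n + 1)) i)) ∈
        R.domain := hw
    show R.integrand (fun i => w (Equiv.swap (Fin.castSucc (Fin.last n)) (Fin.last (n + 1)) i)) =
      R'.integrand w
    rw [hRi hw', hR'i (hWR' hw)]
    simp only [Fin.prod_univ_castSucc, wn_rb_swap_castSucc_castSucc, Equiv.swap_apply_left,
      Equiv.swap_apply_right]
    ring
  -- (3) bookkeeping
  have key : of R - of R' =
      (of R - of (R.reindex (Equiv.swap (Fin.castSucc (Fin.last n)) (Fin.last (n + 1))))) +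
      (of (R.reindex (Equiv.swap (Fin.castSucc (Fin.last n)) (Fin.last (n + 1)))) -
        of (R'.restrict _ hW hWR')) -
      (of R' - of (R'.restrict _ hW hWR')) := by
    abel
  rw [key]
  exact relations.sub_mem (relations.add_mem hS hcmp) hres

end Summit.KontsevichZagierPeriods.HurwitzMicroSectors.NormalFormPrinciple.PiBox.WeightN
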